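import Summits.AnomalousDissipation.AnomalousDissipation.Theorems.TwoAndHalfDTwohalfdThesisStubOcGate
import Literature.Barriers.AnomalousDissipation.ObukhovCorrsinThresholdProofs

/-!
# R5 `stub_ocGateQuantitative` — the quantitative Obukhov–Corrsin gate of the line `Sketch`
(crux stmt-AnomalousDissipation-0206)

Registered tool stub (wave 2) of the line `Sketch` (duhamel-release) for the crux
`Summit.AnomalousDissipation.AnomalousDissipation.Theses.TwoAndHalfD.TwohalfdThesis`
(stmt-AnomalousDissipation-0206): the QUANTITATIVE form of R1 `stub_ocGate`
(`Theorems/TwoAndHalfDTwohalfdThesisStubOcGate`).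

CONTENT (`stub_ocGateQuantitative`, the registered planar statement). Classical releases `φ j s` of
one smooth pattern `h` into drifts `v j` (diffusivity `ν j > 0`, `ν j → 0`) from every time `s ≥ 0`,
which lose the fraction `δ` of `‖h‖²` by age `τ₀ > 0` from every release time `s ≥ s₀`. Fix Hölder
exponents `α, β ∈ (0,1]` above the Obukhov–Corrsin line, `α + 2β > 1`, and a drift budget `K`. Then
there is `c = c(K, τ₀) > 0` such that for all large `j`, every `s ≥ s₀` and every level `M`: if the
shifted drift `t ↦ v j (s+t)` lies in `L¹(0,τ₀; C^{0,α})` with norm `≤ K`, `‖h‖_{C^{0,β}} ≤ M`, and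
`‖φ j s (s+t)‖_{C^{0,β}} ≤ M` for a.e. `t ∈ (0,τ₀)`, then
`c · δ · ‖h‖² · (ν j)^{-(α+2β-1)/(α+1)} ≤ M²` — the `C^β` budget of the released scalar over tame
drifts grows like a POWER of `1/ν_j`.

PROOF. For one classical release `θ` on `[0, ∞) × T^d` with `0 < κ ≤ min 1 (4^{-(α+1)})`
(`ocGateQ_loss_le`, every dimension): `θ` is a weak solution on `[0, τ₀)` with datum `θ 0`
(`IsClassicalScalarTransportOn.isWeakScalarTransportOn_holds`) obeying the energy clause
(`ocGate_lintegral_sq_add_two_mul_eScalarDissipation_eq`, R1's file), so the fixed-scale bound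
`DrivasElgindiIyerJeong2022_thm4.two_mul_eScalarDissipation_le` ((5.10) before optimisation in `ℓ`)
applies at the admissible scale `ε = κ^{1/(α+1)} ≤ 1/4`:
`2κ∫₀^{τ₀}‖∇θ‖² ≤ M²ε^{2β} + 2(2dC₁M²ε^{α+2β-1}K + τ₀κ dC₁²M²ε^{2β-2})`, `C₁ = Torus.gradProfileMass d`;
each of the three terms is `≤ M² κ^p × const`, `p = (α+2β-1)/(α+1)` (`ε^{2β} = κ^{2β/(α+1)} ≤ κ^p` as
`κ ≤ 1` and `2β ≥ α+2β-1`; `ε^{α+2β-1} = κ^p`; `κ ε^{2β-2} = κ^p`), and the energy equality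
`‖θ 0‖² = ‖θ τ₀‖² + 2κ∫₀^{τ₀}‖∇θ‖²` (`scalarL2Sq_add_scalarDissipation_holds`) converts dissipation into
loss: `‖θ 0‖² − ‖θ τ₀‖² ≤ M² κ^p (1 + 4dC₁K + 2dτ₀C₁²)`. For the released family (`d = 2`): eventually
`ν j ≤ min 1 (4^{-(α+1)})`; the shifted release `t ↦ φ j s (s+t)` is classical on `[0, ∞)`
(`isClassicalScalarTransportOn_comp_add_const`) with datum `h`, and the loss hypothesis gives
`δ‖h‖² ≤ ‖h‖² − ‖φ j s (s+τ₀)‖²`; take `c := (1 + 8C₁K + 4τ₀C₁²)⁻¹`.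
Supports stmt-AnomalousDissipation-0206. [cite: DrivasEtAl2022, proof of Thm. 4, (5.9)–(5.10)]
-/

noncomputable section

-- the summit path `AnomalousDissipation/AnomalousDissipation` duplicates a namespace component
set_option linter.dupNamespace false

namespace Summit.AnomalousDissipation.AnomalousDissipation.Theorems.TwohalfdThesis

open MeasureTheory Set Filter Topology
open scoped ENNReal NNReal
open Literature.Analysis.FunctionSpaces Literature.Analysis.FluidPDE

section General

variable {d : Type*} [Fintype d] [DecidableEq d]

/-- **The quantitative Obukhov–Corrsin gate for one classical release (every dimension).** Let `θ`
be a classical solution of `∂ₜθ + u·∇θ = κΔθ` on `[0, ∞) × T^d` with `0 < κ ≤ 1`,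
`κ ≤ 4^{-(α+1)}`, datum `‖θ 0‖_{C^{0,β}} ≤ M`, drift `u ∈ L¹(0,τ₀; C^{0,α})` of norm `≤ K`, and
`‖θ(t)‖_{C^{0,β}} ≤ M` for a.e. `t ∈ (0, τ₀)`, where `α ≤ 1`, `0 < β`. Then the variance lost on the
window obeys `‖θ 0‖² − ‖θ τ₀‖² ≤ M² κ^{(α+2β-1)/(α+1)} (1 + 4dC₁K + 2dτ₀C₁²)`,
`C₁ = Torus.gradProfileMass d`, `d = card d`: the fixed-scale bound
`DrivasElgindiIyerJeong2022_thm4.two_mul_eScalarDissipation_le` at the scale `ε = κ^{1/(α+1)}`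
(admissible, `ε ≤ 1/4`), the three exponent identities `ε^{2β} ≤ κ^p`, `ε^{α+2β-1} = κ^p`,
`κε^{2β-2} = κ^p`, and the energy equality of the classical solution.
[cite: DrivasEtAl2022, proof of Thm. 4, (5.9)–(5.10)] -/
theorem ocGateQ_loss_le {τ₀ : ℝ} (hτ₀ : 0 < τ₀) {α β K M : ℝ≥0} (hα1 : α ≤ 1) (hβ : 0 < β)
    {κ : ℝ} (hκ : 0 < κ) (hκ1 : κ ≤ 1) (hκ4 : κ ≤ (1 / 4 : ℝ) ^ ((α : ℝ) + 1))
    {u : ℝ → UnitAddTorus d → EuclideanSpace ℝ d} {θ : ℝ → UnitAddTorus d → ℝ}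
    (hθ : Torus.IsClassicalScalarTransportOn (Ici 0) κ u θ)
    (hu : MemLpHolder 1 α u (Ioo 0 τ₀)) (huK : eLpHolderNorm 1 α u (Ioo 0 τ₀) ≤ K)
    (hθ₀ : eBoundedHolderNorm β (θ 0) ≤ M)
    (hbound : ∀ᵐ t ∂(volume.restrict (Ioo 0 τ₀)), eBoundedHolderNorm β (θ t) ≤ M) :
    Torus.scalarL2Sq (θ 0) - Torus.scalarL2Sq (θ τ₀) ≤
      (M : ℝ) ^ 2 * κ ^ (((α : ℝ) + 2 * β - 1) / ((α : ℝ) + 1)) *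
        (1 + 4 * Fintype.card d * Torus.gradProfileMass d * K +
          2 * Fintype.card d * τ₀ * Torus.gradProfileMass d ^ 2) := by
  -- the classical solution is a weak solution with datum `θ 0` obeying the energy clause
  have hweak : Torus.IsWeakScalarTransportOn τ₀ κ u (θ 0) θ :=
    Torus.IsClassicalScalarTransportOn.isWeakScalarTransportOn_holds hθ Icc_subset_Ici_self
  have henergy : ∀ᵐ t ∂(volume.restrict (Ioo 0 τ₀)),
      (∫⁻ x, ‖θ t x‖ₑ ^ 2) + 2 * Torus.eScalarDissipation κ θ 0 t ≤ ∫⁻ x, ‖θ 0 x‖ₑ ^ 2 :=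
    (ae_restrict_mem measurableSet_Ioo).mono fun t ht =>
      (ocGate_lintegral_sq_add_two_mul_eScalarDissipation_eq hκ.le hθ ht.1).le
  -- the scale `ε = κ^{1/(α+1)}`
  have hα1pos : (0 : ℝ) < α + 1 := by positivity
  set γ : ℝ := ((α : ℝ) + 1)⁻¹ with hγ
  have hγ0 : 0 ≤ γ := by positivity
  set p : ℝ := ((α : ℝ) + 2 * β - 1) / ((α : ℝ) + 1) with hp
  set ε : ℝ := κ ^ γ with hε_def
  have hε : 0 < ε := Real.rpow_pos_of_pos hκ γ
  have hε' : ε ≤ 1 / 4 := by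
    calc ε ≤ ((1 / 4 : ℝ) ^ ((α : ℝ) + 1)) ^ γ := Real.rpow_le_rpow hκ.le hκ4 hγ0
      _ = 1 / 4 := by
          rw [← Real.rpow_mul (by norm_num : (0 : ℝ) ≤ 1 / 4), hγ, mul_inv_cancel₀ hα1pos.ne',
            Real.rpow_one]
  -- the fixed-scale bound, in `ℝ`
  have hraw := Literature.Barriers.AnomalousDissipation.DrivasElgindiIyerJeong2022_thm4.two_mul_eScalarDissipation_le
    hτ₀ hβ hu huK hθ₀ hκ hweak henergy hbound hε hε'
  have h2 : (2 : ℝ≥0∞) * Torus.eScalarDissipation κ θ 0 τ₀ =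
      ENNReal.ofReal (2 * Torus.scalarDissipation κ θ 0 τ₀) := by
    rw [Torus.eScalarDissipation_eq_ofReal hκ.le hτ₀ (hθ.restrict_Icc hτ₀ Icc_subset_Ici_self),
      ENNReal.ofReal_mul zero_le_two, ENNReal.ofReal_ofNat]
  rw [h2] at hraw
  set C₁ : ℝ := Torus.gradProfileMass d with hC₁
  have hC₁0 : 0 ≤ C₁ := Torus.gradProfileMass_nonneg
  have hRHS0 : 0 ≤ (M : ℝ) ^ 2 * ε ^ (2 * (β : ℝ)) +
      2 * ((2 * Fintype.card d * C₁ * (M : ℝ) ^ 2 * ε ^ ((α : ℝ) + 2 * β - 1)) * K +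
        τ₀ * (κ * (Fintype.card d * (C₁ ^ 2 * (M : ℝ) ^ 2 * ε ^ (2 * (β : ℝ) - 2))))) := by
    positivity
  have hreal := (ENNReal.ofReal_le_ofReal_iff hRHS0).1 hraw
  -- exponent bookkeeping: every term is `≤ M² κ^p × const`
  have hle1 : (α : ℝ) ≤ 1 := by exact_mod_cast hα1
  have t1 : ε ^ (2 * (β : ℝ)) ≤ κ ^ p := by
    rw [hε_def, ← Real.rpow_mul hκ.le]
    refine Real.rpow_le_rpow_of_exponent_ge hκ hκ1 ?_
    rw [hp, hγ, inv_mul_eq_div]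
    gcongr
    linarith
  have t2 : ε ^ ((α : ℝ) + 2 * β - 1) = κ ^ p := by
    rw [hε_def, ← Real.rpow_mul hκ.le, hγ, inv_mul_eq_div]
  have t3 : κ * ε ^ (2 * (β : ℝ) - 2) = κ ^ p := by
    rw [hε_def, ← Real.rpow_mul hκ.le]
    calc κ * κ ^ (γ * (2 * (β : ℝ) - 2))
        = κ ^ (1 : ℝ) * κ ^ (γ * (2 * (β : ℝ) - 2)) := by rw [Real.rpow_one]
      _ = κ ^ (1 + γ * (2 * (β : ℝ) - 2)) := (Real.rpow_add hκ _ _).symm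
      _ = κ ^ p := by
          congr 1
          rw [hγ, hp]
          field_simp
          ring
  have hfin : (M : ℝ) ^ 2 * ε ^ (2 * (β : ℝ)) +
      2 * ((2 * Fintype.card d * C₁ * (M : ℝ) ^ 2 * ε ^ ((α : ℝ) + 2 * β - 1)) * K +
        τ₀ * (κ * (Fintype.card d * (C₁ ^ 2 * (M : ℝ) ^ 2 * ε ^ (2 * (β : ℝ) - 2))))) ≤
      (M : ℝ) ^ 2 * κ ^ p * (1 + 4 * Fintype.card d * C₁ * K + 2 * Fintype.card d * τ₀ * C₁ ^ 2) := by
    have e3 : τ₀ * (κ * (Fintype.card d * (C₁ ^ 2 * (M : ℝ) ^ 2 * ε ^ (2 * (β : ℝ) - 2)))) =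
        τ₀ * (Fintype.card d * (C₁ ^ 2 * (M : ℝ) ^ 2)) * (κ * ε ^ (2 * (β : ℝ) - 2)) := by ring
    rw [t2, e3, t3]
    have hM1 : (M : ℝ) ^ 2 * ε ^ (2 * (β : ℝ)) ≤ (M : ℝ) ^ 2 * κ ^ p :=
      mul_le_mul_of_nonneg_left t1 (sq_nonneg (M : ℝ))
    calc _ ≤ (M : ℝ) ^ 2 * κ ^ p +
          2 * ((2 * Fintype.card d * C₁ * (M : ℝ) ^ 2 * κ ^ p) * K +
            τ₀ * (Fintype.card d * (C₁ ^ 2 * (M : ℝ) ^ 2)) * κ ^ p) := by linarith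
      _ = _ := by ring
  -- the energy equality on the whole window
  have hE := Torus.IsClassicalScalarTransportOn.scalarL2Sq_add_scalarDissipation_holds hθ hτ₀.le
    Icc_subset_Ici_self
  linarith

end General

/-- **R5 `stub_ocGateQuantitative` (line `Sketch` = duhamel-release, crux `TwoAndHalfD.TwohalfdThesis`;
registered signature) — the quantitative Obukhov–Corrsin gate: Batchelor-range roughness grows like a
power of `1/ν_j`.** Classical releases `φ j s` of one smooth `h` into the drifts `v j` from every
`s ≥ 0`, losing the fraction `δ` of `‖h‖²` by age `τ₀ > 0` from every release time `s ≥ s₀`, `ν_j → 0`.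
For Hölder exponents `α, β ∈ (0,1]` with `α + 2β > 1` and a drift budget `K` there is
`c = c(K, τ₀) > 0` such that for all large `j`, every `s ≥ s₀` and every level `M`: if the shifted
drift `t ↦ v j (s+t)` lies in `L¹(0,τ₀; C^{0,α})` with norm `≤ K`, `‖h‖_{C^{0,β}} ≤ M` and
`‖φ j s (s+t)‖_{C^{0,β}} ≤ M` for a.e. `t ∈ (0,τ₀)`, then `c·δ·‖h‖²·(ν j)^{-(α+2β-1)/(α+1)} ≤ M²`
(`ocGateQ_loss_le` for the shifted release, `isClassicalScalarTransportOn_comp_add_const`, once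
`ν j ≤ min 1 (4^{-(α+1)})`; `c := (1 + 8C₁K + 4τ₀C₁²)⁻¹`, `C₁ = Torus.gradProfileMass (Fin 2)`).
R1 `stub_ocGate` is the qualitative corollary. [cite: DrivasEtAl2022, proof of Thm. 4, (5.9)–(5.10)] -/
theorem stub_ocGateQuantitative :
    ∀ (ν : ℕ → ℝ) (v : ℕ → ℝ → (UnitAddTorus (Fin 2)) → (EuclideanSpace ℝ (Fin 2))) (h : (UnitAddTorus (Fin 2)) → ℝ)
      (φ : ℕ → ℝ → ℝ → (UnitAddTorus (Fin 2)) → ℝ) (s₀ τ₀ δ : ℝ) (α β K : ℝ≥0),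
      (∀ j, 0 < ν j) → Tendsto ν atTop (𝓝 0) → Torus.IsSmooth h → 0 < τ₀ →
      (∀ j s, 0 ≤ s → Torus.IsClassicalScalarTransportOn (Ici s) (ν j) (v j) (φ j s) ∧ φ j s s = h) →
      0 ≤ s₀ →
      (∀ j s, s₀ ≤ s → Torus.scalarL2Sq (φ j s (s + τ₀)) ≤ (1 - δ) * Torus.scalarL2Sq h) →
      0 < α → α ≤ 1 → 0 < β → β ≤ 1 → 1 < (α : ℝ) + 2 * β →
      ∃ c : ℝ, 0 < c ∧ ∀ᶠ j in atTop, ∀ s, s₀ ≤ s → ∀ M : ℝ≥0,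
        MemLpHolder 1 α (fun t => v j (s + t)) (Ioo 0 τ₀) →
        eLpHolderNorm 1 α (fun t => v j (s + t)) (Ioo 0 τ₀) ≤ K →
        eBoundedHolderNorm β h ≤ M →
        (∀ᵐ t ∂(volume.restrict (Ioo 0 τ₀)), eBoundedHolderNorm β (φ j s (s + t)) ≤ M) →
        c * δ * Torus.scalarL2Sq h * (ν j) ^ (-(((α : ℝ) + 2 * β - 1) / ((α : ℝ) + 1))) ≤ (M : ℝ) ^ 2 := by
  intro ν v h φ s₀ τ₀ δ α β K hν hν0 _hh hτ₀ hφ hs₀ hloss _hα hα1 hβ _hβ1 _hOC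
  -- the constant
  set C₁ : ℝ := Torus.gradProfileMass (Fin 2) with hC₁
  have hC₁0 : 0 ≤ C₁ := Torus.gradProfileMass_nonneg
  set D : ℝ := 1 + 4 * Fintype.card (Fin 2) * C₁ * K + 2 * Fintype.card (Fin 2) * τ₀ * C₁ ^ 2 with hD
  have hD0 : 0 < D := by positivity
  refine ⟨D⁻¹, inv_pos.2 hD0, ?_⟩
  -- eventually `ν j ≤ min 1 (4^{-(α+1)})`
  have h4pos : (0 : ℝ) < (1 / 4 : ℝ) ^ ((α : ℝ) + 1) := Real.rpow_pos_of_pos (by norm_num) _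
  have hev₁ : ∀ᶠ j in atTop, ν j ≤ 1 :=
    (hν0.eventually (Iic_mem_nhds one_pos)).mono fun j hj => hj
  have hev₂ : ∀ᶠ j in atTop, ν j ≤ (1 / 4 : ℝ) ^ ((α : ℝ) + 1) :=
    (hν0.eventually (Iic_mem_nhds h4pos)).mono fun j hj => hj
  filter_upwards [hev₁, hev₂] with j hj₁ hj₂
  intro s hs M hmem hK hhM hbound
  have hs0 : 0 ≤ s := hs₀.trans hs
  obtain ⟨hcl, hφss⟩ := hφ j s hs0
  -- the shifted release `t ↦ φ j s (s + t)` is classical on `[0, ∞)` with datum `h`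
  have hshift : Torus.IsClassicalScalarTransportOn (Ici 0) (ν j) (fun t => v j (s + t))
      (fun t => φ j s (s + t)) := by
    have h2 := isClassicalScalarTransportOn_comp_add_const hcl s
    rw [Set.preimage_add_const_Ici, sub_self] at h2
    have hu : (fun t => v j (s + t)) = fun σ => v j (σ + s) := funext fun σ => by rw [add_comm]
    have hθ : (fun t => φ j s (s + t)) = fun σ => φ j s (σ + s) := funext fun σ => by rw [add_comm]
    rw [hu, hθ]
    exact h2
  have hhM' : eBoundedHolderNorm β (φ j s (s + 0)) ≤ M := by rw [add_zero, hφss]; exact hhM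
  -- the quantitative gate for this release: `‖h‖² − ‖φ j s (s+τ₀)‖² ≤ M² (ν j)^p D`
  have hmain : Torus.scalarL2Sq (φ j s (s + 0)) - Torus.scalarL2Sq (φ j s (s + τ₀)) ≤
      (M : ℝ) ^ 2 * ν j ^ (((α : ℝ) + 2 * β - 1) / ((α : ℝ) + 1)) * D :=
    ocGateQ_loss_le hτ₀ hα1 hβ (hν j) hj₁ hj₂ hshift hmem hK hhM' hbound
  rw [add_zero, hφss] at hmain
  -- … while the loss is `≥ δ‖h‖²`
  have hl := hloss j s hs
  have key : δ * Torus.scalarL2Sq h ≤ (M : ℝ) ^ 2 * ν j ^ (((α : ℝ) + 2 * β - 1) / ((α : ℝ) + 1)) * D := by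
    linarith
  have hκp : 0 < ν j ^ (((α : ℝ) + 2 * β - 1) / ((α : ℝ) + 1)) := Real.rpow_pos_of_pos (hν j) _
  rw [Real.rpow_neg (hν j).le,
    show D⁻¹ * δ * Torus.scalarL2Sq h * (ν j ^ (((α : ℝ) + 2 * β - 1) / ((α : ℝ) + 1)))⁻¹ =
      δ * Torus.scalarL2Sq h / (D * ν j ^ (((α : ℝ) + 2 * β - 1) / ((α : ℝ) + 1))) by ring,
    div_le_iff₀ (by positivity)]
  calc δ * Torus.scalarL2Sq h ≤ _ := key
    _ = _ := by ring

end Summit.AnomalousDissipation.AnomalousDissipation.Theorems.TwohalfdThesis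

end
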